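import Mathlib
import HarnessLib
import Summits.HubbardSuperconductivity.HubbardSuperconductivity.Theorems.KLProgrammeC4aBubbleTubeDerivAll
import Summits.HubbardSuperconductivity.HubbardSuperconductivity.Theorems.KLProgrammeC4aPathJetsSix

/-!
# Route `KLProgramme` — crux C4a, S3 brick (B4, DIRECT SHEET): the MIXED-JET CEILING — `|∂²_φ ∂ᵐ_ψ ē(0,φ;0,ϑ)| ≤ (m+2)!·𝒦·D^{m+2}` from the frame tables,
# discharging the last hypothesis of the two-node control

Cell `gate-hubbard-kl`, seat hubbard-kl-k3c3-p3 (g25; row «implicit-function / monotonicity route for μ(n)»).  Located brick «(B4)-DIRECT-COUNT» (memo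
HOME/hubbard-kl-k3c3-p3/B4-DIRECT-COUNT.md §1 (v)): the hypothesis `hM` (a ceiling for the second loop-angle derivative of the `m`-th base-angle jet profile of the pp partner
band at the loop's Fermi level) of `…C4aTwoNodeControl.abs_iteratedDeriv_partnerBand_pp_base_le_mul_abs` / `…C4aBandDistanceControl.abs_iteratedDeriv_partnerBand_pp_base_le_band_distance`
is a table row: with `P(φ,ψ) := Φ(0,ψ) + Φ(0,ϑ+ψ) − Φ(0,φ+ψ)` (a sum of three copies of the level-`0` chart curve along affine maps of the `(φ,ψ)`-plane, sup norm) and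
`ē(0,φ;0,ϑ,ψ) = e_K(P(φ,ψ))`,

* §1 (generic, any normed spaces): iterated directional derivatives ARE the Fréchet derivative on the direction tuple — `D_w[y ↦ Dⁿg(y)(v)] = D^{n+1}g(w :: v)`
  (`fderiv_iteratedFDeriv_apply_eq_cons`), `(step_v)^[m] g = Dᵐg(v,…,v)` (`iterate_fderiv_apply_eq_iteratedFDeriv`), sections of `G : ℝ × ℝ → F` in either variable as iterates of the
  section-derivative steps (`iteratedDeriv_section_snd_eq_iterate`, `iteratedDeriv_two_section_fst_eq`), hence **`norm_iteratedDeriv_two_iteratedDeriv_section_le`**: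
  `‖∂²_s ∂ᵐ_t G(s,t)‖ ≤ ‖D^{m+2}G(s,t)‖` (no symmetry of higher derivatives is used: the slot order `(e₁,e₁,e₂,…,e₂)` is the nesting order);
* §2 (the configuration map): `‖Dⁱ(q ↦ Φ₀(c + Lq))‖ ≤ msD6 i·‖L‖ⁱ`, **`norm_iteratedFDeriv_pairConfig_le`** `‖DⁱP‖ ≤ (2 + 2ⁱ)·msD6 i` (`‖snd‖ ≤ 1`, `‖fst + snd‖ ≤ 2`), and by Mathlib's
  `norm_iteratedFDeriv_comp_le` **`norm_iteratedFDeriv_partnerBand_plane_le`**: `‖Dⁿ(e_K ∘ P)(q)‖ ≤ n!·𝒦·Dⁿ` given `‖Dⁱe_K‖ ≤ 𝒦` (`i ≤ n`) and rows `(2 + 2ⁱ)·msD6 i ≤ Dⁱ`;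
* §3 **`abs_iteratedDeriv_two_partnerBand_pp_jet_profile_le`** — the `hM` row: for `m ≤ 4` and every `φ`,
  `|∂²_φ (∂ᵐ_ψ|_θ e_K(Φ(0,ψ) + Φ(0,ϑ+ψ) − Φ(0,φ+ψ)))| ≤ (m+2)!·𝒦·D^{m+2}`.

Binder shape = `…C4aPathJetsSix` (`hA hA20 hd hr hlo hhi hA₃ hA₄ hA₅ hA₆`).  Pure calculus on landed objects; nothing about the model's sizes; nothing asserts (C), K3 or
superconductivity.  References: FST II CPAM 51 (1998) §3; BGM 2006 §2.4 [cite: BenfattoGiulianiMastropietro2006].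
-/

noncomputable section

namespace Summit.HubbardSuperconductivity.HubbardSuperconductivity.Theorems.C4a

set_option linter.dupNamespace false -- summit = problem name (single-conjunct summit), D-0017

open Real Set Filter
open scoped Topology ContDiff
open Literature.MathematicalPhysics.QuantumLattice Literature.MathematicalPhysics.QuantumLattice.BandSectorCounting Literature.Probability.LatticeModels
open Summit.HubbardSuperconductivity.HubbardSuperconductivity.Theorems.KLRegimeSplit
open Summit.HubbardSuperconductivity.HubbardSuperconductivity.Theorems.DispersionFlow
open Summit.HubbardSuperconductivity.HubbardSuperconductivity.Theorems.PerturbedFermiCurve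

/-! ## §1 Mixed partials are bounded by the Fréchet derivative (generic) -/

section Generic

variable {E F : Type*} [NormedAddCommGroup E] [NormedSpace ℝ E] [NormedAddCommGroup F] [NormedSpace ℝ F]

/-- `q ↦ Dⁿg(q)(v)` is smooth for smooth `g` (evaluation at a fixed tuple is a continuous linear map). -/
theorem contDiff_iteratedFDeriv_apply_const {g : E → F} (hg : ContDiff ℝ ∞ g) (n : ℕ) (v : Fin n → E) :
    ContDiff ℝ ∞ fun q => iteratedFDeriv ℝ n g q v := by
  have hD : ContDiff ℝ ∞ (iteratedFDeriv ℝ n g) := hg.iteratedFDeriv_right (m := ∞) (by exact_mod_cast le_top)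
  have h := (ContinuousMultilinearMap.apply ℝ (fun _ : Fin n => E) F v).contDiff.comp hD
  simpa [Function.comp_def] using h

/-- One more directional derivative in front: `D_w[y ↦ Dⁿg(y)(v)](q) = D^{n+1}g(q)(w :: v)`. -/
theorem fderiv_iteratedFDeriv_apply_eq_cons {g : E → F} (hg : ContDiff ℝ ∞ g) (n : ℕ) (v : Fin n → E) (q w : E) :
    fderiv ℝ (fun y => iteratedFDeriv ℝ n g y v) q w = iteratedFDeriv ℝ (n + 1) g q (Fin.cons w v) := by
  have hD : ContDiff ℝ ∞ (iteratedFDeriv ℝ n g) := hg.iteratedFDeriv_right (m := ∞) (by exact_mod_cast le_top)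
  have hDd : DifferentiableAt ℝ (iteratedFDeriv ℝ n g) q := (hD.differentiable (by simp)).differentiableAt
  set ev : (E [×n]→L[ℝ] F) →L[ℝ] F := ContinuousMultilinearMap.apply ℝ (fun _ : Fin n => E) F v with hev
  have hfun : (fun y => iteratedFDeriv ℝ n g y v) = ev ∘ iteratedFDeriv ℝ n g := by
    funext y; simp [hev]
  rw [hfun, (ev.hasFDerivAt.comp q hDd.hasFDerivAt).fderiv, ContinuousLinearMap.comp_apply, hev, ContinuousMultilinearMap.apply_apply,
    iteratedFDeriv_succ_apply_left]
  rfl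

/-- The `m`-fold section derivative in a fixed direction is the iterated Fréchet derivative on the constant tuple:
`(step_v)^[m] g = (q ↦ Dᵐg(q)(v,…,v))`, `step_v G := q ↦ DG(q)v`. -/
theorem iterate_fderiv_apply_eq_iteratedFDeriv {g : E → F} (hg : ContDiff ℝ ∞ g) (v : E) (m : ℕ) :
    (fun G : E → F => fun q => fderiv ℝ G q v)^[m] g = fun q => iteratedFDeriv ℝ m g q (fun _ => v) := by
  induction m with
  | zero => funext q; simp
  | succ k ih =>
    rw [Function.iterate_succ_apply', ih]
    funext q
    rw [fderiv_iteratedFDeriv_apply_eq_cons hg k (fun _ => v) q v]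
    congr 1
    funext i
    refine Fin.cases ?_ (fun j => ?_) i <;> simp

/-- Iterates of the section-derivative step preserve smoothness. -/
theorem contDiff_iterate_fderiv_apply {g : E → F} (hg : ContDiff ℝ ∞ g) (v : E) (m : ℕ) :
    ContDiff ℝ ∞ ((fun G : E → F => fun q => fderiv ℝ G q v)^[m] g) := by
  rw [iterate_fderiv_apply_eq_iteratedFDeriv hg v m]
  exact contDiff_iteratedFDeriv_apply_const hg m _

/-- Second-variable sections of `G : ℝ × ℝ → F`: `∂ᵐ_t [G(s,·)](t) = (step_{(0,1)})^[m] G (s,t)`. -/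
theorem iteratedDeriv_section_snd_eq_iterate (m : ℕ) :
    ∀ {G : ℝ × ℝ → F}, ContDiff ℝ ∞ G → ∀ s t : ℝ,
      iteratedDeriv m (fun t : ℝ => G (s, t)) t = ((fun H : ℝ × ℝ → F => fun q => fderiv ℝ H q ((0 : ℝ), (1 : ℝ)))^[m] G) (s, t) := by
  induction m with
  | zero => intro G _ s t; simp
  | succ k ih =>
    intro G hG s t
    rw [iteratedDeriv_section_succ (V := ℝ) hG k s t, Function.iterate_succ_apply]
    exact ih (contDiff_fderiv_apply_section (V := ℝ) hG) s t

/-- First-variable derivative of a section: `d/ds G(s,t) = DG(s,t)(1,0)`. -/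
theorem deriv_section_fst_eq_fderiv {G : ℝ × ℝ → F} (hG : ContDiff ℝ ∞ G) (s t : ℝ) :
    deriv (fun s : ℝ => G (s, t)) s = fderiv ℝ G (s, t) ((1 : ℝ), (0 : ℝ)) := by
  have hGd : DifferentiableAt ℝ G (s, t) := (hG.differentiable (by simp)).differentiableAt
  have hc : HasDerivAt (fun s : ℝ => ((s, t) : ℝ × ℝ)) ((1 : ℝ), (0 : ℝ)) s := (hasDerivAt_id s).prodMk (hasDerivAt_const s t)
  exact (hGd.hasFDerivAt.comp_hasDerivAt s hc).deriv

/-- Second first-variable derivative of a section: `d²/ds² G(s,t) = (step_{(1,0)})^[2] G (s,t)`. -/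
theorem iteratedDeriv_two_section_fst_eq {G : ℝ × ℝ → F} (hG : ContDiff ℝ ∞ G) (s t : ℝ) :
    iteratedDeriv 2 (fun s : ℝ => G (s, t)) s =
      ((fun H : ℝ × ℝ → F => fun q => fderiv ℝ H q ((1 : ℝ), (0 : ℝ)))^[2] G) (s, t) := by
  have h1 : ContDiff ℝ ∞ (fun q : ℝ × ℝ => fderiv ℝ G q ((1 : ℝ), (0 : ℝ))) := (hG.fderiv_right (m := ∞) le_rfl).clm_apply contDiff_const
  rw [iteratedDeriv_succ, iteratedDeriv_one]
  have hd : deriv (fun s : ℝ => G (s, t)) = fun s => fderiv ℝ G (s, t) ((1 : ℝ), (0 : ℝ)) := funext fun s => deriv_section_fst_eq_fderiv hG s t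
  rw [hd, deriv_section_fst_eq_fderiv h1 s t]
  simp [Function.iterate_succ_apply']

/-- **MIXED PARTIALS ARE BOUNDED BY THE FRÉCHET DERIVATIVE**: for `G : ℝ × ℝ → F` smooth,
`‖∂²_s ∂ᵐ_t G(s,t)‖ ≤ ‖D^{m+2}G(s,t)‖` (sup norm on `ℝ × ℝ`, so `‖(1,0)‖ = ‖(0,1)‖ = 1`). -/
theorem norm_iteratedDeriv_two_iteratedDeriv_section_le {G : ℝ × ℝ → F} (hG : ContDiff ℝ ∞ G) (m : ℕ) (s t : ℝ) :
    ‖iteratedDeriv 2 (fun s : ℝ => iteratedDeriv m (fun t : ℝ => G (s, t)) t) s‖ ≤ ‖iteratedFDeriv ℝ (m + 2) G (s, t)‖ := by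
  set e₁ : ℝ × ℝ := ((1 : ℝ), (0 : ℝ)) with he₁
  set e₂ : ℝ × ℝ := ((0 : ℝ), (1 : ℝ)) with he₂
  -- the inner sections as a smooth function on the plane
  have hinner : (fun s : ℝ => iteratedDeriv m (fun t : ℝ => G (s, t)) t) =
      fun s : ℝ => (fun q : ℝ × ℝ => iteratedFDeriv ℝ m G q (fun _ : Fin m => e₂)) (s, t) := by
    funext s
    rw [iteratedDeriv_section_snd_eq_iterate m hG s t, iterate_fderiv_apply_eq_iteratedFDeriv hG e₂ m]
  have hH : ContDiff ℝ ∞ (fun q : ℝ × ℝ => iteratedFDeriv ℝ m G q (fun _ : Fin m => e₂)) := contDiff_iteratedFDeriv_apply_const hG m _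
  rw [hinner, iteratedDeriv_two_section_fst_eq hH s t]
  simp only [Function.iterate_succ_apply', Function.iterate_zero_apply]
  rw [show (fun q : ℝ × ℝ => fderiv ℝ (fun q => iteratedFDeriv ℝ m G q fun _ => e₂) q e₁) =
      fun q => iteratedFDeriv ℝ (m + 1) G q (Fin.cons e₁ fun _ => e₂) from funext fun q => fderiv_iteratedFDeriv_apply_eq_cons hG m _ q e₁,
    fderiv_iteratedFDeriv_apply_eq_cons hG (m + 1) _ (s, t) e₁]
  refine (ContinuousMultilinearMap.le_opNorm _ _).trans ?_
  have hnorm : ∀ i : Fin (m + 1 + 1), ‖(Fin.cons e₁ (Fin.cons e₁ fun _ : Fin m => e₂) : Fin (m + 1 + 1) → ℝ × ℝ) i‖ = 1 := by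
    intro i
    refine Fin.cases ?_ (fun j => ?_) i
    · simp [he₁, Prod.norm_def]
    · refine Fin.cases ?_ (fun l => ?_) j
      · simp [he₁, Prod.norm_def]
      · simp [he₂, Prod.norm_def]
  rw [Finset.prod_congr rfl fun i _ => hnorm i, Finset.prod_const_one, mul_one]


end Generic

/-! ## §2 The configuration map `P(φ,ψ) = Φ₀(ψ) + Φ₀(ϑ+ψ) − Φ₀(φ+ψ)` and the composite `e_K ∘ P` on the plane -/

section Sizes

variable {K : TrigPolyC4v} {A : ℝ} (hA : ∀ p : Momentum, ∀ j ≤ 2, ‖iteratedFDeriv ℝ j (frameShift K) p‖ ≤ A) (hA20 : A ≤ 1 / 20)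
  (hd : klCurveD ≤ (bandBounds (show (-4 : ℝ) < -1.1 by norm_num) (show (-1.1 : ℝ) ≤ -0.1 by norm_num)
    (show (-0.1 : ℝ) < 0 by norm_num)).Dtmin - 2 * A)
  {μ r : ℝ} (hr : 0 < r) (hlo : (-1.1 : ℝ) < μ - r - A) (hhi : μ + r + A < -0.1)
  {A₃ A₄ A₅ A₆ : ℝ} (hA₃ : ∀ p : Momentum, ‖iteratedFDeriv ℝ 3 (frameShift K) p‖ ≤ A₃)
  (hA₄ : ∀ p : Momentum, ‖iteratedFDeriv ℝ 4 (frameShift K) p‖ ≤ A₄)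
  (hA₅ : ∀ p : Momentum, ‖iteratedFDeriv ℝ 5 (frameShift K) p‖ ≤ A₅)
  (hA₆ : ∀ p : Momentum, ‖iteratedFDeriv ℝ 6 (frameShift K) p‖ ≤ A₆)
include hA hA20 hd hr hlo hhi hA₃ hA₄ hA₅ hA₆

omit hA20 hA₃ hA₄ hA₅ hA₆ in
/-- The level-`0` chart curve is `C^∞`. -/
theorem contDiff_levelPoint_zero_top : ContDiff ℝ ∞ (levelPoint μ K 0) := by
  have h0 : |(0 : ℝ)| < r := by simpa using hr
  exact contDiff_infty.2 fun i => contDiff_levelPoint_of_sizes hA hd hlo hhi h0 i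

/-- **One chart term along an affine map of the plane**: `‖Dⁱ(q ↦ Φ₀(c + L q))(q)‖ ≤ msD6 i · ‖L‖ⁱ` (`1 ≤ i ≤ 6`). -/
theorem norm_iteratedFDeriv_levelPoint_comp_affine_le (c : ℝ) (L : ℝ × ℝ →L[ℝ] ℝ) {i : ℕ} (hi1 : 1 ≤ i) (hi6 : i ≤ 6) (q : ℝ × ℝ) :
    ‖iteratedFDeriv ℝ i (fun q : ℝ × ℝ => levelPoint μ K 0 (c + L q)) q‖ ≤ msD6 A₃ A₄ A₅ A₆ i * ‖L‖ ^ i := by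
  have h0 : |(0 : ℝ)| < r := by simpa using hr
  have hΦ : ContDiff ℝ ∞ (levelPoint μ K 0) := contDiff_levelPoint_zero_top hA hd hr hlo hhi
  have hΦc : ContDiff ℝ ∞ (fun z : ℝ => levelPoint μ K 0 (c + z)) := hΦ.comp (contDiff_const.add contDiff_id)
  have hfun : (fun q : ℝ × ℝ => levelPoint μ K 0 (c + L q)) = (fun z : ℝ => levelPoint μ K 0 (c + z)) ∘ L := rfl
  rw [hfun, ContinuousLinearMap.iteratedFDeriv_comp_right L hΦc q (by exact_mod_cast le_top), iteratedFDeriv_comp_add_left]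
  refine (ContinuousMultilinearMap.norm_compContinuousLinearMap_le _ _).trans ?_
  rw [Finset.prod_const, Finset.card_univ, Fintype.card_fin, norm_iteratedFDeriv_eq_norm_iteratedDeriv]
  exact mul_le_mul_of_nonneg_right (norm_iteratedDeriv_levelPoint_le_six hA hA20 hd hlo hhi hA₃ hA₄ hA₅ hA₆ h0 hi1 hi6 _) (by positivity)

/-- **Derivative rows of the configuration map** `P(φ,ψ) = Φ₀(ψ) + Φ₀(ϑ+ψ) − Φ₀(φ+ψ)`: `‖DⁱP(q)‖ ≤ (2 + 2ⁱ)·msD6 i` for `1 ≤ i ≤ 6` (sup norm on the plane: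
`‖snd‖ ≤ 1`, `‖fst + snd‖ ≤ 2`). -/
theorem norm_iteratedFDeriv_pairConfig_le (ϑ : ℝ) {i : ℕ} (hi1 : 1 ≤ i) (hi6 : i ≤ 6) (q : ℝ × ℝ) :
    ‖iteratedFDeriv ℝ i (fun q : ℝ × ℝ => levelPoint μ K 0 q.2 + levelPoint μ K 0 (ϑ + q.2) - levelPoint μ K 0 (q.1 + q.2)) q‖ ≤
      (2 + 2 ^ i) * msD6 A₃ A₄ A₅ A₆ i := by
  have hΦ : ContDiff ℝ ∞ (levelPoint μ K 0) := contDiff_levelPoint_zero_top hA hd hr hlo hhi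
  set L₂ : ℝ × ℝ →L[ℝ] ℝ := ContinuousLinearMap.snd ℝ ℝ ℝ with hL₂
  set L₁₂ : ℝ × ℝ →L[ℝ] ℝ := ContinuousLinearMap.fst ℝ ℝ ℝ + ContinuousLinearMap.snd ℝ ℝ ℝ with hL₁₂
  have hn₂ : ‖L₂‖ ≤ 1 := ContinuousLinearMap.norm_snd_le ℝ ℝ ℝ
  have hn₁₂ : ‖L₁₂‖ ≤ 2 := by
    refine (norm_add_le _ _).trans ?_
    have := ContinuousLinearMap.norm_fst_le ℝ ℝ ℝ
    have := ContinuousLinearMap.norm_snd_le ℝ ℝ ℝ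
    linarith
  -- the three terms as affine compositions
  have e1 : (fun q : ℝ × ℝ => levelPoint μ K 0 q.2) = fun q => levelPoint μ K 0 (0 + L₂ q) := by funext q; simp [hL₂]
  have e2 : (fun q : ℝ × ℝ => levelPoint μ K 0 (ϑ + q.2)) = fun q => levelPoint μ K 0 (ϑ + L₂ q) := by funext q; simp [hL₂]
  have e3 : (fun q : ℝ × ℝ => levelPoint μ K 0 (q.1 + q.2)) = fun q => levelPoint μ K 0 (0 + L₁₂ q) := by funext q; simp [hL₁₂]
  have hΦi : ContDiff ℝ i (levelPoint μ K 0) := hΦ.of_le (by exact_mod_cast le_top)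
  have c1 : ContDiff ℝ i (fun q : ℝ × ℝ => levelPoint μ K 0 q.2) := hΦi.comp contDiff_snd
  have c2 : ContDiff ℝ i (fun q : ℝ × ℝ => levelPoint μ K 0 (ϑ + q.2)) := hΦi.comp (contDiff_const.add contDiff_snd)
  have c3 : ContDiff ℝ i (fun q : ℝ × ℝ => levelPoint μ K 0 (q.1 + q.2)) := hΦi.comp (contDiff_fst.add contDiff_snd)
  rw [show (fun q : ℝ × ℝ => levelPoint μ K 0 q.2 + levelPoint μ K 0 (ϑ + q.2) - levelPoint μ K 0 (q.1 + q.2)) =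
      ((fun q : ℝ × ℝ => levelPoint μ K 0 q.2) + fun q : ℝ × ℝ => levelPoint μ K 0 (ϑ + q.2)) - fun q : ℝ × ℝ => levelPoint μ K 0 (q.1 + q.2) from rfl,
    iteratedFDeriv_sub_apply (f := (fun q : ℝ × ℝ => levelPoint μ K 0 q.2) + fun q : ℝ × ℝ => levelPoint μ K 0 (ϑ + q.2))
      (g := fun q : ℝ × ℝ => levelPoint μ K 0 (q.1 + q.2)) (c1.add c2).contDiffAt c3.contDiffAt,
    iteratedFDeriv_add_apply (f := fun q : ℝ × ℝ => levelPoint μ K 0 q.2) (g := fun q : ℝ × ℝ => levelPoint μ K 0 (ϑ + q.2))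
      c1.contDiffAt c2.contDiffAt]
  refine (norm_sub_le _ _).trans ((add_le_add_left (norm_add_le _ _) _).trans ?_)
  have b1 := norm_iteratedFDeriv_levelPoint_comp_affine_le hA hA20 hd hr hlo hhi hA₃ hA₄ hA₅ hA₆ 0 L₂ hi1 hi6 q
  have b2 := norm_iteratedFDeriv_levelPoint_comp_affine_le hA hA20 hd hr hlo hhi hA₃ hA₄ hA₅ hA₆ ϑ L₂ hi1 hi6 q
  have b3 := norm_iteratedFDeriv_levelPoint_comp_affine_le hA hA20 hd hr hlo hhi hA₃ hA₄ hA₅ hA₆ 0 L₁₂ hi1 hi6 q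
  rw [← e1] at b1; rw [← e2] at b2; rw [← e3] at b3
  have hD0 : 0 ≤ msD6 A₃ A₄ A₅ A₆ i := (norm_nonneg _).trans
    (norm_iteratedDeriv_levelPoint_le_six hA hA20 hd hlo hhi hA₃ hA₄ hA₅ hA₆ (by simpa using hr : |(0:ℝ)| < r) hi1 hi6 0)
  have p2 : ‖L₂‖ ^ i ≤ 1 := pow_le_one₀ (norm_nonneg _) hn₂
  have p12 : ‖L₁₂‖ ^ i ≤ 2 ^ i := pow_le_pow_left₀ (norm_nonneg _) hn₁₂ i
  nlinarith [mul_le_mul_of_nonneg_left p2 hD0, mul_le_mul_of_nonneg_left p12 hD0]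

omit hA20 hA₃ hA₄ hA₅ hA₆ in
/-- The configuration map is `C^∞` on the plane. -/
theorem contDiff_pairConfig (ϑ : ℝ) :
    ContDiff ℝ ∞ (fun q : ℝ × ℝ => levelPoint μ K 0 q.2 + levelPoint μ K 0 (ϑ + q.2) - levelPoint μ K 0 (q.1 + q.2)) := by
  have hΦ : ContDiff ℝ ∞ (levelPoint μ K 0) := contDiff_levelPoint_zero_top hA hd hr hlo hhi
  exact ((hΦ.comp contDiff_snd).add (hΦ.comp (contDiff_const.add contDiff_snd))).sub (hΦ.comp (contDiff_fst.add contDiff_snd))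

/-- **The composite `e_K ∘ P` on the plane**: `‖Dⁿ(e_K ∘ P)(q)‖ ≤ n!·𝒦·Dⁿ` whenever `‖Dⁱe_K‖ ≤ 𝒦` for `i ≤ n` (value included) and `(2 + 2ⁱ)·msD6 i ≤ Dⁱ` for
`1 ≤ i ≤ n ≤ 6` (Mathlib's `norm_iteratedFDeriv_comp_le`). -/
theorem norm_iteratedFDeriv_partnerBand_plane_le (ϑ : ℝ) {n : ℕ} (hn : n ≤ 6) {𝒦 : ℝ}
    (hK : ∀ i, i ≤ n → ∀ p : Momentum, ‖iteratedFDeriv ℝ i (frameLevel μ K) p‖ ≤ 𝒦)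
    {D : ℝ} (hDrow : ∀ i, 1 ≤ i → i ≤ n → (2 + 2 ^ i) * msD6 A₃ A₄ A₅ A₆ i ≤ D ^ i) (q : ℝ × ℝ) :
    ‖iteratedFDeriv ℝ n (fun q : ℝ × ℝ => frameLevel μ K (levelPoint μ K 0 q.2 + levelPoint μ K 0 (ϑ + q.2) - levelPoint μ K 0 (q.1 + q.2))) q‖ ≤
      n.factorial * 𝒦 * D ^ n := by
  have hP := contDiff_pairConfig hA hd hr hlo hhi ϑ
  have hfun : (fun q : ℝ × ℝ => frameLevel μ K (levelPoint μ K 0 q.2 + levelPoint μ K 0 (ϑ + q.2) - levelPoint μ K 0 (q.1 + q.2))) =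
      frameLevel μ K ∘ fun q : ℝ × ℝ => levelPoint μ K 0 q.2 + levelPoint μ K 0 (ϑ + q.2) - levelPoint μ K 0 (q.1 + q.2) := rfl
  rw [hfun]
  exact norm_iteratedFDeriv_comp_le (EngineV8.contDiff_frameLevel μ K (n := ∞)) hP (by exact_mod_cast le_top) q
    (fun i hi => hK i hi _) (fun i hi1 hi => (norm_iteratedFDeriv_pairConfig_le hA hA20 hd hr hlo hhi hA₃ hA₄ hA₅ hA₆ ϑ hi1 (hi.trans hn) q).trans (hDrow i hi1 hi))

/-! ## §3 The mixed-jet ceiling (the `hM` row of the two-node control) -/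

/-- **THE MIXED-JET CEILING**: for `m ≤ 4`, with `‖Dⁱe_K‖ ≤ 𝒦` (`i ≤ m+2`) and rows `(2 + 2ⁱ)·msD6 i ≤ Dⁱ` (`1 ≤ i ≤ m+2`), every loop angle `φ` has
`|∂²_φ (∂ᵐ_ψ|_θ e_K(Φ(0,ψ) + Φ(0,ϑ+ψ) − Φ(0,φ+ψ)))| ≤ (m+2)!·𝒦·D^{m+2}` — the hypothesis `hM` of `…C4aTwoNodeControl` / `…C4aBandDistanceControl` with
`M = (m+2)!·𝒦·D^{m+2}`, on any window. -/
theorem abs_iteratedDeriv_two_partnerBand_pp_jet_profile_le {m : ℕ} (hm : m ≤ 4) {𝒦 : ℝ}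
    (hK : ∀ i, i ≤ m + 2 → ∀ p : Momentum, ‖iteratedFDeriv ℝ i (frameLevel μ K) p‖ ≤ 𝒦)
    {D : ℝ} (hDrow : ∀ i, 1 ≤ i → i ≤ m + 2 → (2 + 2 ^ i) * msD6 A₃ A₄ A₅ A₆ i ≤ D ^ i) (ϑ θ φ : ℝ) :
    |iteratedDeriv 2 (fun φ : ℝ =>
        iteratedDeriv m (fun ψ : ℝ => frameLevel μ K (levelPoint μ K 0 ψ + levelPoint μ K 0 (ϑ + ψ) - levelPoint μ K 0 (φ + ψ))) θ) φ| ≤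
      (m + 2).factorial * 𝒦 * D ^ (m + 2) := by
  have hP := contDiff_pairConfig hA hd hr hlo hhi ϑ
  have hG : ContDiff ℝ ∞ (fun q : ℝ × ℝ => frameLevel μ K (levelPoint μ K 0 q.2 + levelPoint μ K 0 (ϑ + q.2) - levelPoint μ K 0 (q.1 + q.2))) :=
    (EngineV8.contDiff_frameLevel μ K (n := ∞)).comp hP
  have hsec : (fun φ : ℝ => iteratedDeriv m (fun ψ : ℝ => frameLevel μ K (levelPoint μ K 0 ψ + levelPoint μ K 0 (ϑ + ψ) - levelPoint μ K 0 (φ + ψ))) θ) =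
      fun s : ℝ => iteratedDeriv m (fun t : ℝ =>
        (fun q : ℝ × ℝ => frameLevel μ K (levelPoint μ K 0 q.2 + levelPoint μ K 0 (ϑ + q.2) - levelPoint μ K 0 (q.1 + q.2))) (s, t)) θ := rfl
  rw [hsec, ← Real.norm_eq_abs]
  refine (norm_iteratedDeriv_two_iteratedDeriv_section_le hG m φ θ).trans ?_
  exact norm_iteratedFDeriv_partnerBand_plane_le hA hA20 hd hr hlo hhi hA₃ hA₄ hA₅ hA₆ ϑ (by omega) hK hDrow (φ, θ)

end Sizes

end Summit.HubbardSuperconductivity.HubbardSuperconductivity.Theorems.C4a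

end
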